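import Mathlib.NumberTheory.Chebyshev
import Mathlib.Analysis.Complex.ExponentialBounds
import Literature.NumberTheory.EllipticCurves.TateSeriesFormal
import Literature.NumberTheory.Transcendental.PadicSchwarzLemma
import Literature.NumberTheory.Transcendental.PadicLiouvilleInequality
import HarnessLib

/-!
# The Mahler–Manin theorem, steps 2–3: `p`-adic values of the auxiliary function and the
# zero estimate along `q^ℓ`, `ℓ` prime

Everything in this file is **proved**; there are no new definitions.  Second and third steps of
the `p`-adic proof of the Mahler–Manin conjecture after Barré-Sirieix–Diaz–Gramain–Philibert
(1996) (cf. Nesterenko–Philippon LNM 1752, Ch. 2, §2.5, second and third steps, for the complex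
case), for an integer power series `F = Σ bₙ Xⁿ ∈ ℤ⟦X⟧` vanishing to order `M` at `0`
(`bₙ = 0` for `n < M`, `b_M ≠ 0`) and its `p`-adic values `F(z) = evalSeries F z`, `‖z‖_p < 1`:

* `evalSeries_sum_C_mul_X_pow_mul` — `p`-adic value of the auxiliary series of
  `MahlerManinSiegelStep.lean`: `F_a(z) = Σ_λ a_λ z^{λ₁} (z J(z))^{λ₂}`, `z J(z) = evalSeries formalXJ z`
  (`TateSeriesFormal.evalSeries_formalXJ`);
* `evalSeries_eq_pow_mul_tsum`, `norm_evalSeries_le_pow` — **second step** (trivial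
  ultrametrically): `F(z) = z^M G(z)`, `G(z) = Σ b_{M+ν} z^ν`, `‖G(z)‖ ≤ 1`, so `‖F(z)‖ ≤ ‖z‖^M`;
* `sum_mul_log_le_log_abs_coeff` — **third step (zero estimate)**: if `F(q^ℓ) = 0` for all `ℓ`
  in a finite set `P` of positive integers, the ultrametric Schwarz lemma
  (`PadicSchwarzLemma.norm_coeff_zero_le_mul_prod`) gives `‖b_M‖_p ≤ ‖q‖^{Σ_{ℓ ∈ P} ℓ}`, while
  `‖b_M‖_p ≥ 1/|b_M|` for the nonzero integer `b_M`; hence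
  `(Σ_{ℓ ∈ P} ℓ) · log(1/‖q‖) ≤ log |b_M|`;
* `exists_prime_evalSeries_ne_zero`, `exists_least_prime` — some prime `ℓ` has `F(q^ℓ) ≠ 0`, and
  for the least such prime `S` all smaller primes are zeros, so
  `(Σ_{ℓ < S prime} ℓ) log(1/‖q‖) ≤ log |b_M|`;
* `sq_div_log_sq_le_sum_primesBelow` — Chebyshev (`Mathlib`'s `Chebyshev.pi_ge`):
  `Σ_{ℓ < S prime} ℓ ≥ S²/(32 log² S)` for `S ≥ 16`.

## References

* [BarreSirieixDiazGramainPhilibert1996Manin] Invent. Math. 124 (1996) 1–9, §2–3.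
* [NesterenkoPhilippon2001] LNM 1752, Ch. 2 (G. Diaz), §2.5, second and third steps.
-/

noncomputable section

open Finset PowerSeries Filter Real IsUltrametricDist Literature.NumberTheory.EllipticCurves

namespace Literature.NumberTheory.Transcendental

/-! ### `p`-adic values of integer power series -/

section Eval

variable {K : Type*} [NontriviallyNormedField K] [IsUltrametricDist K] [CompleteSpace K]

omit [IsUltrametricDist K] [CompleteSpace K] in
/-- `evalSeries 0 z = 0`. [folklore] -/
theorem evalSeries_zero (z : K) : evalSeries 0 z = 0 := by
  simp [evalSeries]

omit [IsUltrametricDist K] [CompleteSpace K] in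
/-- `evalSeries (C c) z = c`. [folklore] -/
theorem evalSeries_C (c : ℤ) (z : K) : evalSeries (PowerSeries.C c) z = c := by
  rw [evalSeries, tsum_eq_single 0 fun n hn ↦ by rw [coeff_C, if_neg hn, Int.cast_zero, zero_mul]]
  rw [coeff_C, if_pos rfl, pow_zero, mul_one]

/-- Evaluation commutes with finite sums on the open unit disc. [folklore] -/
theorem evalSeries_finset_sum {ι : Type*} (s : Finset ι) (φ : ι → PowerSeries ℤ) {z : K}
    (hz : ‖z‖ < 1) : evalSeries (∑ i ∈ s, φ i) z = ∑ i ∈ s, evalSeries (φ i) z := by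
  classical
  induction s using Finset.induction_on with
  | empty => simp [evalSeries_zero]
  | insert a s has ih => rw [sum_insert has, sum_insert has, evalSeries_add _ _ hz, ih]

/-- **`p`-adic value of the auxiliary series**: for `0 < ‖z‖ < 1`,
`evalSeries (Σ_λ C(a_λ) X^{λ₁} (XJ)^{λ₂}) z = Σ_λ a_λ z^{λ₁} (z J(z))^{λ₂}` with
`J(z) = tateJ z = E₄(z)³/Δ(z)`. [folklore] -/
theorem evalSeries_sum_C_mul_X_pow_mul (s : Finset (ℕ × ℕ)) (a : ℕ × ℕ → ℤ) {z : K} (hz0 : z ≠ 0)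
    (hz : ‖z‖ < 1) :
    evalSeries (∑ l ∈ s, PowerSeries.C (a l) * X ^ l.1 * formalXJ ^ l.2) z =
      ∑ l ∈ s, (a l : K) * z ^ l.1 * (z * tateJ z) ^ l.2 := by
  rw [evalSeries_finset_sum _ _ hz]
  refine sum_congr rfl fun l _ ↦ ?_
  rw [evalSeries_mul _ _ hz, evalSeries_mul _ _ hz, evalSeries_C, evalSeries_X_pow,
    evalSeries_pow _ hz, evalSeries_formalXJ hz0 hz]

/-- **Second step: factoring out the zero of order `M` at `0`.**  If `coeffₙ F = 0` for `n < M`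
then `F(z) = z^M · Σ_ν coeff_{M+ν}(F) z^ν` on the open unit disc. [folklore] -/
theorem evalSeries_eq_pow_mul_tsum (φ : PowerSeries ℤ) {M : ℕ} (hM : ∀ n < M, coeff n φ = 0)
    {z : K} (hz : ‖z‖ < 1) :
    evalSeries φ z = z ^ M * ∑' ν, ((coeff (M + ν) φ : ℤ) : K) * z ^ ν := by
  rw [evalSeries, ← (summable_coeff_mul_pow φ hz).sum_add_tsum_nat_add M,
    sum_eq_zero fun n hn ↦ by rw [hM n (mem_range.mp hn), Int.cast_zero, zero_mul], zero_add,
    ← tsum_mul_left]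
  exact tsum_congr fun ν ↦ by rw [add_comm ν M, pow_add]; ring

omit [CompleteSpace K] in
/-- The cofactor `G(z) = Σ_ν coeff_{M+ν}(F) z^ν` has norm `≤ 1` on the closed unit disc (integer
coefficients). [folklore] -/
theorem norm_tsum_coeff_shift_le_one (φ : PowerSeries ℤ) (M : ℕ) {z : K} (hz : ‖z‖ ≤ 1) :
    ‖∑' ν, ((coeff (M + ν) φ : ℤ) : K) * z ^ ν‖ ≤ 1 :=
  norm_tsum_mul_pow_le zero_le_one (fun ν ↦ norm_intCast_le_one K (coeff (M + ν) φ)) hz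

/-- **Second step: the upper bound `‖F(z)‖ ≤ ‖z‖^M`** for a series vanishing to order `M` at `0`
(Nesterenko–Philippon Ch. 2 §2.5, second step; trivial in the ultrametric case).
[cite: NesterenkoPhilippon2001, Ch. 2, §2.5] -/
theorem norm_evalSeries_le_pow (φ : PowerSeries ℤ) {M : ℕ} (hM : ∀ n < M, coeff n φ = 0) {z : K}
    (hz : ‖z‖ < 1) : ‖evalSeries φ z‖ ≤ ‖z‖ ^ M := by
  rw [evalSeries_eq_pow_mul_tsum φ hM hz, norm_mul, norm_pow]
  exact mul_le_of_le_one_right (pow_nonneg (norm_nonneg _) _)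
    (norm_tsum_coeff_shift_le_one φ M hz.le)

/-- A zero `z ≠ 0` of `F` in the disc is a zero of the cofactor `G`. [folklore] -/
theorem tsum_coeff_shift_eq_zero (φ : PowerSeries ℤ) {M : ℕ} (hM : ∀ n < M, coeff n φ = 0)
    {z : K} (hz0 : z ≠ 0) (hz : ‖z‖ < 1) (h : evalSeries φ z = 0) :
    ∑' ν, ((coeff (M + ν) φ : ℤ) : K) * z ^ ν = 0 := by
  rw [evalSeries_eq_pow_mul_tsum φ hM hz] at h
  exact (mul_eq_zero.mp h).resolve_left (pow_ne_zero M hz0)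

end Eval

/-! ### Third step: the zero estimate along `q^ℓ` -/

variable {p : ℕ} [Fact p.Prime]

/-- `‖b‖_p ≥ 1/|b|` for a nonzero integer `b`. [folklore] -/
theorem inv_abs_le_padicNorm_intCast {b : ℤ} (hb : b ≠ 0) : (|(b : ℝ)|)⁻¹ ≤ ‖(b : ℚ_[p])‖ := by
  have h := inv_natCast_le_norm_natCast (p := p) (n := b.natAbs) (Int.natAbs_ne_zero.mpr hb)
  have h1 : ((b.natAbs : ℕ) : ℝ) = |(b : ℝ)| := by rw [Nat.cast_natAbs, Int.cast_abs]
  have h2 : ‖((b.natAbs : ℕ) : ℚ_[p])‖ = ‖(b : ℚ_[p])‖ := by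
    rw [Nat.cast_natAbs]
    rcases abs_choice b with h | h <;> rw [h]
    rw [Int.cast_neg, norm_neg]
  rw [h1, h2] at h
  exact h

/-- **Third step (ultrametric Schwarz lemma along `q^ℓ`).**  Let `F ∈ ℤ⟦X⟧` vanish to order `M` at
`0` with `b_M = coeff_M F ≠ 0`, let `0 < ‖q‖_p < 1`, and let `P` be a finite set of positive
integers with `F(q^ℓ) = 0` for all `ℓ ∈ P`.  Then `(Σ_{ℓ ∈ P} ℓ) · log(1/‖q‖) ≤ log |b_M|`
(from `1/|b_M| ≤ ‖b_M‖_p ≤ ∏_{ℓ ∈ P} ‖q^ℓ‖`, `PadicSchwarzLemma.norm_coeff_zero_le_mul_prod`).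
[cite: NesterenkoPhilippon2001, Ch. 2, §2.5] -/
theorem sum_mul_log_le_log_abs_coeff {q : ℚ_[p]} (hq0 : q ≠ 0) (hq1 : ‖q‖ < 1)
    {φ : PowerSeries ℤ} {M : ℕ} (hM : ∀ n < M, coeff n φ = 0) (hbM : coeff M φ ≠ 0)
    (P : Finset ℕ) (hP : ∀ ℓ ∈ P, ℓ ≠ 0) (hzero : ∀ ℓ ∈ P, evalSeries φ (q ^ ℓ) = 0) :
    (∑ ℓ ∈ P, (ℓ : ℝ)) * (-Real.log ‖q‖) ≤ Real.log |((coeff M φ : ℤ) : ℝ)| := by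
  classical
  have hr0 : 0 < ‖q‖ := norm_pos_iff.mpr hq0
  -- the Schwarz lemma for `G(z) = Σ b_{M+ν} z^ν` on the set `{q^ℓ : ℓ ∈ P}`
  set b : ℕ → ℚ_[p] := fun ν ↦ ((coeff (M + ν) φ : ℤ) : ℚ_[p]) with hb
  have hbB : ∀ ν, ‖b ν‖ ≤ 1 := fun ν ↦ norm_intCast_le_one ℚ_[p] _
  have hs1 : ∀ a ∈ P.image (fun ℓ ↦ q ^ ℓ), ‖a‖ < 1 := by
    intro a ha
    obtain ⟨ℓ, hℓ, rfl⟩ := mem_image.mp ha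
    rw [norm_pow]
    exact pow_lt_one₀ (norm_nonneg _) hq1 (hP ℓ hℓ)
  have hs0 : ∀ a ∈ P.image (fun ℓ ↦ q ^ ℓ), ∑' n, b n * a ^ n = 0 := by
    intro a ha
    obtain ⟨ℓ, hℓ, rfl⟩ := mem_image.mp ha
    exact tsum_coeff_shift_eq_zero φ hM (pow_ne_zero ℓ hq0)
      (by rw [norm_pow]; exact pow_lt_one₀ (norm_nonneg _) hq1 (hP ℓ hℓ)) (hzero ℓ hℓ)
  have hSchwarz := norm_coeff_zero_le_mul_prod (P.image fun ℓ ↦ q ^ ℓ) hbB hs1 hs0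
  have hinj : Set.InjOn (fun ℓ : ℕ ↦ q ^ ℓ) P := by
    intro ℓ _ ℓ' _ h
    have := congr_arg norm h
    simp only [norm_pow] at this
    exact pow_right_injective₀ hr0 hq1.ne this
  rw [prod_image hinj, one_mul] at hSchwarz
  simp only [hb, add_zero, norm_pow] at hSchwarz
  rw [prod_pow_eq_pow_sum] at hSchwarz
  -- `1/|b_M| ≤ ‖b_M‖_p ≤ ‖q‖ ^ (Σ ℓ)`
  have hlow := inv_abs_le_padicNorm_intCast (p := p) hbM
  have habs : 0 < |((coeff M φ : ℤ) : ℝ)| := abs_pos.mpr (Int.cast_ne_zero.mpr hbM)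
  have h := hlow.trans hSchwarz
  -- take logarithms
  have h' := Real.log_le_log (inv_pos.mpr habs) h
  rw [Real.log_inv, Real.log_pow, Nat.cast_sum] at h'
  linarith

/-- Some prime `ℓ` has `F(q^ℓ) ≠ 0` (otherwise every prime would be a zero, and a single large
prime `ℓ > log|b_M| / log(1/‖q‖)` already contradicts the zero estimate). [folklore] -/
theorem exists_prime_evalSeries_ne_zero {q : ℚ_[p]} (hq0 : q ≠ 0) (hq1 : ‖q‖ < 1)
    {φ : PowerSeries ℤ} {M : ℕ} (hM : ∀ n < M, coeff n φ = 0) (hbM : coeff M φ ≠ 0) :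
    ∃ ℓ : ℕ, ℓ.Prime ∧ evalSeries φ (q ^ ℓ) ≠ 0 := by
  by_contra! hall
  have hlam : 0 < -Real.log ‖q‖ := by
    rw [neg_pos]
    exact Real.log_neg (norm_pos_iff.mpr hq0) hq1
  -- a prime beyond the zero estimate
  obtain ⟨ℓ, hℓ, hprime⟩ := Nat.exists_infinite_primes
    (⌈Real.log |((coeff M φ : ℤ) : ℝ)| / (-Real.log ‖q‖)⌉₊ + 1)
  have h := sum_mul_log_le_log_abs_coeff hq0 hq1 hM hbM {ℓ} (fun l hl ↦ by
    rw [mem_singleton] at hl; subst hl; exact hprime.ne_zero) (fun l hl ↦ by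
    rw [mem_singleton] at hl; subst hl; exact hall l hprime)
  rw [sum_singleton] at h
  have h1 : Real.log |((coeff M φ : ℤ) : ℝ)| / (-Real.log ‖q‖) < ℓ := by
    have := Nat.le_ceil (Real.log |((coeff M φ : ℤ) : ℝ)| / (-Real.log ‖q‖))
    have h2 : (⌈Real.log |((coeff M φ : ℤ) : ℝ)| / (-Real.log ‖q‖)⌉₊ : ℝ) + 1 ≤ ℓ := by
      exact_mod_cast hℓ
    linarith
  rw [div_lt_iff₀ hlam] at h1
  linarith

/-- **The least non-vanishing prime.**  There is a prime `S` with `F(q^S) ≠ 0` such that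
`F(q^ℓ) = 0` for every prime `ℓ < S`; consequently
`(Σ_{ℓ < S, ℓ prime} ℓ) · log(1/‖q‖) ≤ log |b_M|`. [cite: NesterenkoPhilippon2001, Ch. 2, §2.5] -/
theorem exists_least_prime {q : ℚ_[p]} (hq0 : q ≠ 0) (hq1 : ‖q‖ < 1)
    {φ : PowerSeries ℤ} {M : ℕ} (hM : ∀ n < M, coeff n φ = 0) (hbM : coeff M φ ≠ 0) :
    ∃ S : ℕ, S.Prime ∧ evalSeries φ (q ^ S) ≠ 0 ∧ (∀ ℓ < S, ℓ.Prime → evalSeries φ (q ^ ℓ) = 0) ∧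
      (∑ ℓ ∈ S.primesBelow, (ℓ : ℝ)) * (-Real.log ‖q‖) ≤ Real.log |((coeff M φ : ℤ) : ℝ)| := by
  classical
  have hex := exists_prime_evalSeries_ne_zero hq0 hq1 hM hbM
  refine ⟨Nat.find hex, (Nat.find_spec hex).1, (Nat.find_spec hex).2, fun ℓ hℓ hprime ↦ ?_, ?_⟩
  · by_contra h
    exact Nat.find_min hex hℓ ⟨hprime, h⟩
  · refine sum_mul_log_le_log_abs_coeff hq0 hq1 hM hbM _ (fun ℓ hℓ ↦ ?_) (fun ℓ hℓ ↦ ?_)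
    · exact (Nat.prime_of_mem_primesBelow hℓ).ne_zero
    · by_contra h
      exact Nat.find_min hex (Nat.lt_of_mem_primesBelow hℓ) ⟨Nat.prime_of_mem_primesBelow hℓ, h⟩

/-! ### Chebyshev: `Σ_{ℓ < S prime} ℓ ≥ S² / (32 log² S)` -/

/-- The sum of a finite set of natural numbers is at least `0 + 1 + ⋯ + (k - 1)`, `k` its
cardinality. [folklore] -/
theorem card_mul_card_sub_one_le_two_mul_sum (s : Finset ℕ) :
    s.card * (s.card - 1) ≤ 2 * ∑ x ∈ s, x := by
  -- sort `s` increasingly: the `i`-th element is `≥ i`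
  set k := s.card with hk
  set f : Fin k ↪o ℕ := s.orderEmbOfFin hk.symm with hf
  have hfi : ∀ (n : ℕ) (h : n < k), n ≤ f ⟨n, h⟩ := by
    intro n
    induction n with
    | zero => intro h; exact Nat.zero_le _
    | succ n ih =>
      intro h
      have hlt : f ⟨n, by omega⟩ < f ⟨n + 1, h⟩ :=
        f.strictMono (Fin.mk_lt_mk.mpr (Nat.lt_succ_self n))
      have := ih (by omega)
      omega
  have hsum : ∑ x ∈ s, x = ∑ i : Fin k, f i := by
    rw [← sum_image (f := fun x : ℕ ↦ x) (s := univ) (g := fun i : Fin k ↦ f i)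
      (fun i _ j _ h ↦ f.injective h)]
    congr 1
    ext x
    simp only [mem_image, mem_univ, true_and]
    constructor
    · intro hx
      have : x ∈ Set.range f := by rw [hf, range_orderEmbOfFin]; exact hx
      obtain ⟨i, rfl⟩ := this
      exact ⟨i, rfl⟩
    · rintro ⟨i, rfl⟩
      exact orderEmbOfFin_mem s hk.symm i
  rw [hsum]
  have h2 : ∑ i : Fin k, (i : ℕ) ≤ ∑ i : Fin k, f i := sum_le_sum fun i _ ↦ hfi i.1 i.2
  have h3 : 2 * ∑ i : Fin k, (i : ℕ) = k * (k - 1) := by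
    rw [Fin.sum_univ_eq_sum_range (fun i ↦ i) k, mul_comm, Finset.sum_range_id_mul_two]
  omega

/-- **Chebyshev's bound for the number of primes below `S`**: `π(S - 1) ≥ S / (4 log S) + 1` for
`S ≥ 16` (from Mathlib's `Chebyshev.pi_ge`: `π(n) ≥ (n log 2 − log(n+1)) / log n`). [folklore] -/
theorem div_log_add_one_le_primeCounting' {S : ℕ} (hS : 16 ≤ S) :
    (S : ℝ) / (4 * Real.log S) + 1 ≤ Nat.primeCounting' S := by
  have hS1 : (1 : ℝ) < (S : ℝ) - 1 := by
    have : (16 : ℝ) ≤ S := by exact_mod_cast hS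
    linarith
  have hSpos : (0 : ℝ) < S := by linarith
  have hlogS : 0 < Real.log S := Real.log_pos (by linarith)
  have hlogS1 : 0 < Real.log ((S : ℝ) - 1) := Real.log_pos hS1
  -- Mathlib's Chebyshev bound at `n = S - 1`
  have hpi := Chebyshev.pi_ge (S - 1)
  rw [Nat.primeCounting_sub_one] at hpi
  have hcast : ((S - 1 : ℕ) : ℝ) = (S : ℝ) - 1 := by
    rw [Nat.cast_sub (by omega)]; simp
  rw [hcast, sub_add_cancel] at hpi
  -- numerics: `log 2 > 0.693`, `log S ≤ log 16 + (S - 16)/16 ≤ 2.78 + (S-16)/16`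
  have hlog2 := Real.log_two_gt_d9
  have hlog2' := Real.log_two_lt_d9
  have hlog16 : Real.log 16 = 4 * Real.log 2 := by
    rw [show (16 : ℝ) = 2 ^ 4 by norm_num, Real.log_pow]; norm_num
  have hlogS_le : Real.log S ≤ Real.log 16 + ((S : ℝ) - 16) / 16 := by
    have h := Real.log_le_sub_one_of_pos (show (0 : ℝ) < S / 16 by positivity)
    rw [Real.log_div hSpos.ne' (by norm_num)] at h
    linarith
  -- `log (S - 1) ≤ log S`
  have hlogmono : Real.log ((S : ℝ) - 1) ≤ Real.log S := Real.log_le_log (by linarith) (by linarith)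
  -- from `hpi`: `π' S ≥ ((S-1) log 2 - log S)/log(S-1) ≥ ((S-1) log 2 - log S)/log S`
  have hS16 : (16 : ℝ) ≤ S := by exact_mod_cast hS
  have hA : ((S : ℝ) - 5) * 0.6931471803 ≤ ((S : ℝ) - 5) * Real.log 2 :=
    mul_le_mul_of_nonneg_left hlog2.le (by linarith)
  have hnum_pos : 0 ≤ ((S : ℝ) - 1) * Real.log 2 - Real.log S := by linarith
  have h1 : (((S : ℝ) - 1) * Real.log 2 - Real.log S) / Real.log S ≤ Nat.primeCounting' S :=
    le_trans (div_le_div_of_nonneg_left hnum_pos hlogS1 hlogmono) hpi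
  -- and `S/(4 log S) + 1 ≤ ((S-1) log 2 - log S)/log S`
  refine le_trans ?_ h1
  have heq : (S : ℝ) / (4 * Real.log S) + 1 = ((S : ℝ) / 4 + Real.log S) / Real.log S := by
    field_simp
  rw [heq]
  exact div_le_div_of_nonneg_right (by linarith) hlogS.le

/-- **`Σ_{ℓ < S, ℓ prime} ℓ ≥ S² / (32 log² S)` for `S ≥ 16`** (Chebyshev; the primes below `S` are
`π(S-1) ≥ S/(4 log S) + 1` distinct positive integers). [folklore] -/
theorem sq_div_log_sq_le_sum_primesBelow {S : ℕ} (hS : 16 ≤ S) :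
    (S : ℝ) ^ 2 / (32 * Real.log S ^ 2) ≤ ∑ ℓ ∈ S.primesBelow, (ℓ : ℝ) := by
  have hSpos : (0 : ℝ) < S := by exact_mod_cast (show 0 < S by omega)
  have hlogS : 0 < Real.log S := Real.log_pos (by exact_mod_cast (show 1 < S by omega))
  have hk := div_log_add_one_le_primeCounting' hS
  rw [← Nat.primesBelow_card_eq_primeCounting'] at hk
  have hsum := card_mul_card_sub_one_le_two_mul_sum S.primesBelow
  set k := (S.primesBelow).card with hkdef
  have hk1 : 1 ≤ k := by
    by_contra h
    rw [not_le] at h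
    have : (k : ℝ) = 0 := by exact_mod_cast (Nat.lt_one_iff.mp h)
    rw [this] at hk
    have : (0 : ℝ) < S / (4 * Real.log S) := by positivity
    linarith
  have hsumR : ((k : ℝ) * ((k : ℝ) - 1)) ≤ 2 * ∑ ℓ ∈ S.primesBelow, (ℓ : ℝ) := by
    have : ((k * (k - 1) : ℕ) : ℝ) ≤ ((2 * ∑ x ∈ S.primesBelow, x : ℕ) : ℝ) := by exact_mod_cast hsum
    rw [Nat.cast_mul, Nat.cast_sub hk1, Nat.cast_mul, Nat.cast_sum] at this
    simpa using this
  -- `k - 1 ≥ S/(4 log S)` and `k ≥ S/(4 log S)`, so `k(k-1) ≥ S²/(16 log² S)`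
  have ha : (S : ℝ) / (4 * Real.log S) ≤ (k : ℝ) - 1 := by linarith
  have hb : (S : ℝ) / (4 * Real.log S) ≤ k := by linarith
  have hpos : 0 ≤ (S : ℝ) / (4 * Real.log S) := by positivity
  have hprod : ((S : ℝ) / (4 * Real.log S)) * ((S : ℝ) / (4 * Real.log S)) ≤ (k : ℝ) * ((k : ℝ) - 1) :=
    mul_le_mul hb ha hpos (by positivity)
  have heq : ((S : ℝ) / (4 * Real.log S)) * ((S : ℝ) / (4 * Real.log S)) =
      (S : ℝ) ^ 2 / (16 * Real.log S ^ 2) := by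
    field_simp
    ring
  rw [heq] at hprod
  have : (S : ℝ) ^ 2 / (32 * Real.log S ^ 2) = ((S : ℝ) ^ 2 / (16 * Real.log S ^ 2)) / 2 := by
    field_simp
    ring
  rw [this]
  linarith

end Literature.NumberTheory.Transcendental

end
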